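import Summits.BirchSwinnertonDyer.BirchSwinnertonDyer.Theorems.TameQuarticSolventTprimeFormalTorsionValuationAtThree
import Summits.BirchSwinnertonDyer.BirchSwinnertonDyer.Theorems.TameQuarticSolventTprimePsiThreeRootsAtThree
import Summits.BirchSwinnertonDyer.BirchSwinnertonDyer.Theorems.TameQuarticSolventTprimePsiThreeNewtonSlopes
import Literature.AlgebraicGeometry.PlaneCurves.WeierstrassChordTangent
import HarnessLib

/-!
# Route `TameQuarticSolvent`, crux `SolventPairLowerBound` (stmt-BirchSwinnertonDyer-21391) — the VALUATIONS OF
# THE POINTS OF ORDER `3` on the (t′) good model over the tame quartic ring (Newton polygon of `Ψ₃`), and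
# NO RATIONAL `3`-TORSION over the quartic completion and its `3`-cyclotomic tower on sub-row B

HONEST FRAMING. Theorems only; helper (`--supports stmt-BirchSwinnertonDyer-21391 --as helper`) of width seat
bsd-wall-tqs-p1-w2 g7; point-level companion of `TameQuarticSolventTprimeFormalTorsionValuationAtThree` (p602023, the
same profile for formal `3`-torsion PARAMETERS). Here the statements are about POINTS `P = (x, y)` of order `3` of the
good model `W' ⊗_ψ K` in Mathlib's `WeierstrassCurve.Affine.Point`, via the `3`-division polynomial
`Ψ₃ = 3x⁴ + b₂x³ + 3b₄x² + 3b₆x + b₈` (tree: `addOrderOf_eq_three_iff_Ψ₃_eval_eq_zero`, Silverman–Tate 2.1(c)) —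
no formal group, no completeness. BSD is not proved by any of this; nothing here closes 21391 or 23963.

WHAT. `W'` = the `ϖᵏ`-rescaled good model over `O` (`3 = ϖ⁴u`) of w3 g5's
`tprime_goodModel_formalMul_three_dichotomy`; `ψ : O → K` integral into an ultrametric normed field,
`ϱ = ‖ψ ϖ‖ ∈ (0, 1)`; `P = (x, y) ∈ (W' ⊗_ψ K)(K)` of order `3`:
* sub-row B (`3 ∣ a₂`): **`‖x‖·ϱ = 1` and `‖y‖²·ϱ³ = 1`** (`v(x) = −v(3)/4`, `v(y) = −3v(3)/8`);
* sub-row A (`a₂ = ϖ²·unit`): **`‖x‖·ϱ² = 1 ∧ ‖y‖·ϱ³ = 1`** (the canonical subgroup: `2` points) **or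
  `‖x‖³·ϱ² = 1 ∧ ‖y‖·ϱ = 1`** (the other `6`);
* hence on sub-row B, over any `K` whose value group has ODD index over `ϱ^ℤ` — the completion `M_w` of the solvent
  quartic field (`e = 4`), every layer `M_w(μ_{3ⁿ})` of its `3`-cyclotomic tower, every odd-degree extension —
  **`(W' ⊗ K)(K)` has NO point of order `3`** (`‖y‖² = ϱ⁻³` is not a square in the value group); on sub-row A with
  index prime to `3`, every point of order `3` lies in the canonical subgroup (`‖x‖ = ϱ⁻²`).
The ℚ-level packaging `tprime_goodModel_threeTorsion_norm_dichotomy` /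
`tprime_goodModel_no_threeTorsion_of_subrowB_oddIndex` displays w3 g5's model data (`V`, `T`, `k`, `m`, `W'`) and
the `c₆`-valuation split exactly as `tprime_goodModel_formalThreeTorsion_norm_dichotomy` does.

References: J.-P. Serre, *Propriétés galoisiennes des points d'ordre fini des courbes elliptiques*, Invent. Math. 15
(1972) §1 (valuations of the points of order `p`); J. Lubin, Ann. of Math. 80 (1964) §1; J. H. Silverman, *AEC*
Ex. 3.7, IV.6.1, VII.3; J. Silverman, J. Tate, *Rational Points on Elliptic Curves* Thm. 2.1(c).
[cite: SilvermanAEC2009, Exercise 3.7 and IV.6.1] [cite: SilvermanTate2015, Thm. 2.1 (c)]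
-/

-- D-0017: single-problem summit, so `Summit.BirchSwinnertonDyer.BirchSwinnertonDyer.…` repeats a namespace BY DESIGN.
set_option linter.dupNamespace false

noncomputable section

open Polynomial

namespace Summit.BirchSwinnertonDyer.BirchSwinnertonDyer.Theorems.SolventPairLowerBound

/-! ## §1. The residue field of `K` at hand: `‖ψ b₈‖ = 1` on the good model (supersingular reduction) -/

section GoodModelPoints

open WeierstrassCurve

universe uK

variable {O : Type*} [CommRing O] {K : Type uK} [NormedField K] [IsUltrametricDist K]

/-- **A residue map for an integral `ψ : O → K` with `‖3‖ < 1`.** There is a field `k` of characteristic `3` and a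
ring map `π : O → k` with `π x = 0 ↔ ‖ψ x‖ < 1` (the residue field of the valuation ring of `K`, composed with
`ψ`). [folklore] -/
theorem exists_residueMap_charThree (ψ : O →+* K) (hψ : ∀ x, ‖ψ x‖ ≤ 1) (h3K : ‖(3 : K)‖ < 1) :
    ∃ (k : Type uK) (_ : Field k) (_ : CharP k 3) (π : O →+* k), ∀ x, π x = 0 ↔ ‖ψ x‖ < 1 := by
  classical
  let v : Valuation K NNReal := NormedField.valuation
  have hv : ∀ x : K, v x = ‖x‖₊ := fun x ↦ rfl
  let A : ValuationSubring K := v.valuationSubring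
  have hmemA : ∀ x : K, x ∈ A ↔ ‖x‖ ≤ 1 := fun x ↦ by
    change v x ≤ 1 ↔ _
    rw [hv, ← NNReal.coe_le_coe, coe_nnnorm, NNReal.coe_one]
  have hequiv : v.IsEquiv A.valuation := v.isEquiv_valuation_valuationSubring
  have hmax : ∀ a : A, a ∈ IsLocalRing.maximalIdeal A ↔ ‖(a : K)‖ < 1 := fun a ↦ by
    rw [ValuationSubring.valuation_lt_one_iff, ← hequiv.lt_one_iff_lt_one, hv, ← NNReal.coe_lt_coe,
      coe_nnnorm, NNReal.coe_one]
  let ψA : O →+* A := ψ.codRestrict A fun x ↦ (hmemA _).mpr (hψ x)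
  let k := IsLocalRing.ResidueField A
  let π : A →+* k := IsLocalRing.residue A
  have h3k : (3 : k) = 0 := by
    have h3A : (3 : A) ∈ IsLocalRing.maximalIdeal A := by rw [hmax]; exact_mod_cast h3K
    have := (IsLocalRing.residue_eq_zero_iff (3 : A)).mpr h3A
    rwa [map_ofNat] at this
  refine ⟨k, inferInstance, (CharP.charP_iff_prime_eq_zero Nat.prime_three).mpr h3k, π.comp ψA, fun x ↦ ?_⟩
  rw [RingHom.comp_apply, IsLocalRing.residue_eq_zero_iff, hmax]
  rfl

/-- **`‖ψ b₈‖ = 1` on the good model** (unit discriminant, `a₁ = 0`, `‖ψ a₂‖ < 1`, `‖3‖ < 1`): the reduction is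
nonsingular with `b₂ = 0`, hence `b₈ = −b₄² ≠ 0` (`Δ = b₄³` in characteristic `3`). [Silverman AEC III.1, IV.7.5]
[cite: SilvermanAEC2009, Exercise 3.7] -/
theorem norm_map_b₈_eq_one (ψ : O →+* K) (hψ : ∀ x, ‖ψ x‖ ≤ 1) (h3K : ‖(3 : K)‖ < 1)
    (W' : WeierstrassCurve O) (hΔ : IsUnit W'.Δ) (ha₁ : W'.a₁ = 0) (ha₂ : ‖ψ W'.a₂‖ < 1) :
    ‖ψ W'.b₈‖ = 1 := by
  obtain ⟨k, _, _, π, hπ⟩ := exists_residueMap_charThree ψ hψ h3K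
  have hΔk : (W'.map π).Δ ≠ 0 := by
    rw [WeierstrassCurve.map_Δ]
    intro h
    have := (hπ _).mp h
    rw [norm_map_eq_one_of_isUnit ψ hψ hΔ] at this
    exact lt_irrefl _ this
  have hb₂ : (W'.map π).b₂ = 0 := by
    have : π W'.a₂ = 0 := (hπ _).mpr ha₂
    simp only [WeierstrassCurve.b₂, WeierstrassCurve.map_a₁, WeierstrassCurve.map_a₂, ha₁, map_zero, this]
    ring
  have hb₈ := (W'.map π).b₈_ne_zero_of_b₂_eq_zero hb₂ hΔk
  rw [WeierstrassCurve.map_b₈] at hb₈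
  exact le_antisymm (hψ _) (not_lt.mp fun h ↦ hb₈ ((hπ _).mpr h))

/-- On `y² = x³ + a₂x² + a₄x + a₆` with integral coefficients, a point with `‖x‖ > 1` has `‖y‖² = ‖x‖³`.
[Silverman AEC VII.2 (the chart at `O`: `|x| > 1` on `E₁`)] [folklore] -/
theorem norm_sq_eq_norm_cube_of_equation {V : WeierstrassCurve K} (ha₁ : V.a₁ = 0) (ha₃ : V.a₃ = 0)
    (ha₂ : ‖V.a₂‖ ≤ 1) (ha₄ : ‖V.a₄‖ ≤ 1) (ha₆ : ‖V.a₆‖ ≤ 1) {x y : K} (heq : V.toAffine.Equation x y)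
    (hx : 1 < ‖x‖) : ‖y‖ ^ 2 = ‖x‖ ^ 3 := by
  have hE : y ^ 2 + V.a₁ * x * y + V.a₃ * y - (x ^ 3 + V.a₂ * x ^ 2 + V.a₄ * x + V.a₆) = 0 :=
    (WeierstrassCurve.Affine.equation_iff' x y).1 heq
  rw [ha₁, ha₃] at hE
  have hy : y ^ 2 = x ^ 3 + (V.a₂ * x ^ 2 + V.a₄ * x + V.a₆) := by linear_combination hE
  have hx0 : 0 < ‖x‖ := zero_lt_one.trans hx
  have hlow : ‖V.a₂ * x ^ 2 + V.a₄ * x + V.a₆‖ < ‖x ^ 3‖ := by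
    rw [norm_pow]
    have hx2 : ‖x‖ ^ 2 < ‖x‖ ^ 3 := pow_lt_pow_right₀ hx (by norm_num)
    have b2 : ‖V.a₂ * x ^ 2‖ ≤ ‖x‖ ^ 2 := by
      rw [norm_mul, norm_pow]; exact (mul_le_of_le_one_left (pow_nonneg hx0.le 2) ha₂)
    have b4 : ‖V.a₄ * x‖ ≤ ‖x‖ ^ 2 := by
      rw [norm_mul]
      exact (mul_le_of_le_one_left hx0.le ha₄).trans (by nlinarith)
    have b6 : ‖V.a₆‖ ≤ ‖x‖ ^ 2 := ha₆.trans (one_le_pow₀ hx.le)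
    exact ((IsUltrametricDist.norm_add_le_max _ _).trans (max_le ((IsUltrametricDist.norm_add_le_max _ _).trans
      (max_le b2 b4)) b6)).trans_lt hx2
  rw [← norm_pow, hy, IsUltrametricDist.norm_add_eq_max_of_norm_ne_norm (ne_of_gt hlow), max_eq_left hlow.le,
    norm_pow]

variable [DecidableEq K] (ψ : O →+* K) (hψ : ∀ x, ‖ψ x‖ ≤ 1) {ϖ u : O} (hu : IsUnit u)
  (h3 : (3 : O) = ϖ ^ 4 * u) (hϖ0 : 0 < ‖ψ ϖ‖) (hϖ1 : ‖ψ ϖ‖ < 1)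
include hψ hu h3 hϖ0 hϖ1

omit hϖ0 in
/-- The `Ψ₃`-root equation of a point of order `3` on `W' ⊗_ψ K`, with the coefficient norms of the good model
(`a₁ = a₃ = 0`, unit `Δ`, `‖ψ a₂‖ < 1`): `3x⁴ + 4ψ(a₂)x³ + 3ψ(b₄)x² + 3ψ(b₆)x + ψ(b₈) = 0`, `‖3‖ = ϱ⁴`,
`‖3ψ(b₄)‖, ‖3ψ(b₆)‖ ≤ ϱ⁴`, `‖ψ(b₈)‖ = 1`. [cite: SilvermanTate2015, Thm. 2.1 (c)] -/
theorem Ψ₃_root_of_addOrderOf_eq_three (W' : WeierstrassCurve O) (hΔ : IsUnit W'.Δ) (ha₁ : W'.a₁ = 0)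
    (ha₂ : ‖ψ W'.a₂‖ < 1) {x y : K} (hP : (W'.map ψ).toAffine.Nonsingular x y)
    (h3P : addOrderOf (WeierstrassCurve.Affine.Point.some x y hP) = 3) :
    (3 : K) * x ^ 4 + (4 * ψ W'.a₂) * x ^ 3 + (3 * ψ W'.b₄) * x ^ 2 + (3 * ψ W'.b₆) * x + ψ W'.b₈ = 0 ∧
      ‖(3 : K)‖ = ‖ψ ϖ‖ ^ 4 ∧ ‖3 * ψ W'.b₄‖ ≤ ‖ψ ϖ‖ ^ 4 ∧ ‖3 * ψ W'.b₆‖ ≤ ‖ψ ϖ‖ ^ 4 ∧ ‖ψ W'.b₈‖ = 1 := by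
  classical
  have h3K : ‖(3 : K)‖ = ‖ψ ϖ‖ ^ 4 := norm_three_eq_pow_four ψ hψ hu h3
  have h3K1 : ‖(3 : K)‖ < 1 := by rw [h3K]; exact pow_lt_one₀ (norm_nonneg _) hϖ1 four_ne_zero
  have hroot := (Literature.AlgebraicGeometry.PlaneCurves.addOrderOf_eq_three_iff_Ψ₃_eval_eq_zero
    (W'.map ψ) hP).mp h3P
  rw [eval_Ψ₃_eq, WeierstrassCurve.map_b₂, WeierstrassCurve.map_b₄, WeierstrassCurve.map_b₆,
    WeierstrassCurve.map_b₈] at hroot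
  have hb₂ : ψ W'.b₂ = 4 * ψ W'.a₂ := by
    simp only [WeierstrassCurve.b₂, ha₁, map_add, map_mul, map_pow, map_zero, map_ofNat]; ring
  rw [hb₂] at hroot
  refine ⟨by linear_combination hroot, h3K, ?_, ?_, norm_map_b₈_eq_one ψ hψ h3K1 W' hΔ ha₁ ha₂⟩
  · rw [norm_mul, h3K]; exact mul_le_of_le_one_right (pow_nonneg (norm_nonneg _) 4) (hψ _)
  · rw [norm_mul, h3K]; exact mul_le_of_le_one_right (pow_nonneg (norm_nonneg _) 4) (hψ _)

/-- **Sub-row B: the valuations of a point of order `3` on the good model.** `W'` over `O` (`3 = ϖ⁴u`) with unit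
`Δ`, `a₁ = a₃ = 0`, `3 ∣ a₂`; `ψ : O → K` integral into an ultrametric field, `ϱ = ‖ψ ϖ‖ ∈ (0,1)`; then every
`P = (x, y) ∈ (W' ⊗_ψ K)(K)` of order `3` has **`‖x‖·ϱ = 1` and `‖y‖²·ϱ³ = 1`** (`v(x) = −v(3)/4`,
`v(y) = −3v(3)/8`). [Serre 1972 §1; Silverman AEC IV.6.1] [cite: SilvermanAEC2009, IV.6.1] -/
theorem norm_threeTorsion_of_subrowB (W' : WeierstrassCurve O) (hΔ : IsUnit W'.Δ) (ha₁ : W'.a₁ = 0)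
    (ha₃ : W'.a₃ = 0) (ha₂ : (3 : O) ∣ W'.a₂) {x y : K} (hP : (W'.map ψ).toAffine.Nonsingular x y)
    (h3P : addOrderOf (WeierstrassCurve.Affine.Point.some x y hP) = 3) :
    ‖x‖ * ‖ψ ϖ‖ = 1 ∧ ‖y‖ ^ 2 * ‖ψ ϖ‖ ^ 3 = 1 := by
  have h3K : ‖(3 : K)‖ = ‖ψ ϖ‖ ^ 4 := norm_three_eq_pow_four ψ hψ hu h3
  have h3K1 : ‖(3 : K)‖ < 1 := by rw [h3K]; exact pow_lt_one₀ (norm_nonneg _) hϖ1 four_ne_zero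
  have ha₂' : ‖ψ W'.a₂‖ ≤ ‖ψ ϖ‖ ^ 4 := by
    obtain ⟨z, hz⟩ := ha₂
    rw [hz, map_mul, norm_mul, map_ofNat, h3K]
    exact mul_le_of_le_one_right (pow_nonneg (norm_nonneg _) 4) (hψ z)
  have ha₂1 : ‖ψ W'.a₂‖ < 1 := ha₂'.trans_lt (h3K ▸ h3K1)
  obtain ⟨hroot, h4, hc2, hc1, hc0⟩ := Ψ₃_root_of_addOrderOf_eq_three ψ hψ hu h3 hϖ1 W' hΔ ha₁ ha₂1 hP h3P
  have hc3 : ‖(4 : K) * ψ W'.a₂‖ ≤ ‖ψ ϖ‖ ^ 4 := by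
    rw [norm_mul]
    exact (mul_le_of_le_one_left (norm_nonneg _) (IsUltrametricDist.norm_natCast_le_one K 4 |>.trans_eq'
      (by norm_num))).trans ha₂'
  have hx : ‖x‖ * ‖ψ ϖ‖ = 1 :=
    norm_mul_eq_one_of_quartic_root_oneSlope hϖ0 hϖ1 h4 hc3 hc2 hc1 hc0 hroot
  refine ⟨hx, ?_⟩
  have hx1 : 1 < ‖x‖ := by
    by_contra h
    have : ‖x‖ * ‖ψ ϖ‖ < 1 := (mul_le_of_le_one_left (norm_nonneg _) (not_lt.mp h)).trans_lt hϖ1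
    linarith
  have hy := norm_sq_eq_norm_cube_of_equation (V := W'.map ψ) (by simp [ha₁]) (by simp [ha₃])
    (by simpa using hψ W'.a₂) (by simpa using hψ W'.a₄) (by simpa using hψ W'.a₆) hP.1 hx1
  calc ‖y‖ ^ 2 * ‖ψ ϖ‖ ^ 3 = (‖x‖ * ‖ψ ϖ‖) ^ 3 := by rw [hy]; ring
    _ = 1 := by rw [hx, one_pow]

/-- **Sub-row A: the valuations of a point of order `3` on the good model.** `W'` over `O` (`3 = ϖ⁴u`) with unit
`Δ`, `a₁ = a₃ = 0`, `a₂ = ϖ²·(unit)`; then every `P = (x, y) ∈ (W' ⊗_ψ K)(K)` of order `3` has EITHER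
**`‖x‖·ϱ² = 1 ∧ ‖y‖·ϱ³ = 1`** (the canonical subgroup: `v(x) = −v(3)/2`) OR **`‖x‖³·ϱ² = 1 ∧ ‖y‖·ϱ = 1`**
(`v(x) = −v(3)/6`). [Serre 1972 §1; Katz 1973 Thm. 3.10.7] [cite: SilvermanAEC2009, IV.6.1] -/
theorem norm_threeTorsion_of_subrowA (W' : WeierstrassCurve O) (hΔ : IsUnit W'.Δ) (ha₁ : W'.a₁ = 0)
    (ha₃ : W'.a₃ = 0) (ha₂ : ∃ s₀ : O, IsUnit s₀ ∧ W'.a₂ = ϖ ^ 2 * s₀) {x y : K}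
    (hP : (W'.map ψ).toAffine.Nonsingular x y) (h3P : addOrderOf (WeierstrassCurve.Affine.Point.some x y hP) = 3) :
    (‖x‖ * ‖ψ ϖ‖ ^ 2 = 1 ∧ ‖y‖ * ‖ψ ϖ‖ ^ 3 = 1) ∨ (‖x‖ ^ 3 * ‖ψ ϖ‖ ^ 2 = 1 ∧ ‖y‖ * ‖ψ ϖ‖ = 1) := by
  have h3K : ‖(3 : K)‖ = ‖ψ ϖ‖ ^ 4 := norm_three_eq_pow_four ψ hψ hu h3
  have h3K1 : ‖(3 : K)‖ < 1 := by rw [h3K]; exact pow_lt_one₀ (norm_nonneg _) hϖ1 four_ne_zero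
  obtain ⟨s₀, hs₀, ha₂e⟩ := ha₂
  have hψa₂ : ‖ψ W'.a₂‖ = ‖ψ ϖ‖ ^ 2 := by
    rw [ha₂e, map_mul, map_pow, norm_mul, norm_pow, norm_map_eq_one_of_isUnit ψ hψ hs₀, mul_one]
  have ha₂1 : ‖ψ W'.a₂‖ < 1 := by rw [hψa₂]; exact pow_lt_one₀ (norm_nonneg _) hϖ1 two_ne_zero
  obtain ⟨hroot, h4, hc2, hc1, hc0⟩ := Ψ₃_root_of_addOrderOf_eq_three ψ hψ hu h3 hϖ1 W' hΔ ha₁ ha₂1 hP h3P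
  have h4K : ‖(4 : K)‖ = 1 := by
    have h : (4 : K) = 1 + 3 := by norm_num
    have hne : ‖(1 : K)‖ ≠ ‖(3 : K)‖ := by rw [norm_one]; exact (ne_of_lt h3K1).symm
    rw [h, IsUltrametricDist.norm_add_eq_max_of_norm_ne_norm hne, norm_one, max_eq_left h3K1.le]
  have hc3 : ‖(4 : K) * ψ W'.a₂‖ = ‖ψ ϖ‖ ^ 2 := by rw [norm_mul, h4K, one_mul, hψa₂]
  have hx1_of : ∀ {e : ℕ}, 0 < e → ‖x‖ ^ e * ‖ψ ϖ‖ ^ 2 = 1 → 1 < ‖x‖ := by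
    intro e he h
    by_contra hle
    have h1 : ‖x‖ ^ e ≤ 1 := pow_le_one₀ (norm_nonneg _) (not_lt.mp hle)
    have h2 : ‖ψ ϖ‖ ^ 2 < 1 := pow_lt_one₀ (norm_nonneg _) hϖ1 two_ne_zero
    nlinarith [pow_nonneg (norm_nonneg x) e, pow_nonneg (norm_nonneg (ψ ϖ)) 2]
  have hyeq : 1 < ‖x‖ → ‖y‖ ^ 2 = ‖x‖ ^ 3 := fun hx1 ↦
    norm_sq_eq_norm_cube_of_equation (V := W'.map ψ) (by simp [ha₁]) (by simp [ha₃])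
      (by simpa using hψ W'.a₂) (by simpa using hψ W'.a₄) (by simpa using hψ W'.a₆) hP.1 hx1
  have hy0 : 0 ≤ ‖y‖ := norm_nonneg y
  have hϱ0' : 0 ≤ ‖ψ ϖ‖ := norm_nonneg _
  rcases norm_mul_eq_one_or_of_quartic_root_twoSlopes hϖ0 hϖ1 h4 hc3 hc2 hc1 hc0 hroot with hx | hx
  · left
    refine ⟨hx, ?_⟩
    have hy := hyeq (hx1_of one_pos (by simpa using hx))
    -- `‖y‖² = ‖x‖³ = ϱ⁻⁶`
    have h : (‖y‖ * ‖ψ ϖ‖ ^ 3) ^ 2 = 1 ^ 2 := by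
      calc (‖y‖ * ‖ψ ϖ‖ ^ 3) ^ 2 = ‖y‖ ^ 2 * ‖ψ ϖ‖ ^ 6 := by ring
        _ = (‖x‖ * ‖ψ ϖ‖ ^ 2) ^ 3 := by rw [hy]; ring
        _ = 1 ^ 2 := by rw [hx]; norm_num
    exact (pow_left_inj₀ (by positivity) zero_le_one two_ne_zero).mp h
  · right
    refine ⟨hx, ?_⟩
    have hy := hyeq (hx1_of three_pos hx)
    have h : (‖y‖ * ‖ψ ϖ‖) ^ 2 = 1 ^ 2 := by
      calc (‖y‖ * ‖ψ ϖ‖) ^ 2 = ‖y‖ ^ 2 * ‖ψ ϖ‖ ^ 2 := by ring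
        _ = ‖x‖ ^ 3 * ‖ψ ϖ‖ ^ 2 := by rw [hy]
        _ = 1 ^ 2 := by rw [hx]; norm_num
    exact (pow_left_inj₀ (by positivity) zero_le_one two_ne_zero).mp h

omit [IsUltrametricDist K] hψ hu h3 hϖ0 hϖ1 in
/-- Points killed by `3` are `0` or of order `3`. [folklore] -/
theorem eq_zero_or_addOrderOf_eq_three {V : WeierstrassCurve K} (P : V.toAffine.Point) (h3 : 3 • P = 0) :
    P = 0 ∨ addOrderOf P = 3 := by
  haveI : Fact (Nat.Prime 3) := ⟨Nat.prime_three⟩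
  by_cases hP : P = 0
  · exact Or.inl hP
  · exact Or.inr (addOrderOf_eq_prime_iff.mpr ⟨h3, hP⟩)

/-- **Sub-row B: NO rational `3`-torsion over value groups of odd index.** If every nonzero `z ∈ K` has
`‖z‖^{m'} ∈ ‖ψ ϖ‖^ℤ` for some ODD `m'` (the completion `M_w` of the solvent quartic field at `w ∣ 3`: `m' = 1`;
every layer of its `3`-cyclotomic tower and every extension of odd ramification index over it), then the good model
of a sub-row-B curve has no `K`-point of order `3`: **`3 • P = 0 ⇒ P = 0` on `(W' ⊗_ψ K)(K)`** (`‖y‖² = ϱ⁻³` has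
no solution in the value group). [Serre 1972 §1] [cite: SilvermanAEC2009, IV.6.1] -/
theorem threeTorsion_eq_zero_of_subrowB_oddIndex (W' : WeierstrassCurve O) (hΔ : IsUnit W'.Δ)
    (ha₁ : W'.a₁ = 0) (ha₃ : W'.a₃ = 0) (ha₂ : (3 : O) ∣ W'.a₂) {m' : ℕ} (hm' : Odd m')
    (hval : ∀ z : K, z ≠ 0 → ∃ j : ℤ, ‖z‖ ^ m' = ‖ψ ϖ‖ ^ j)
    (P : (W'.map ψ).toAffine.Point) (h3P : 3 • P = 0) : P = 0 := by
  rcases eq_zero_or_addOrderOf_eq_three P h3P with h0 | hord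
  · exact h0
  exfalso
  rcases P with _ | ⟨x, y, hP⟩
  · have h0 : (WeierstrassCurve.Affine.Point.zero : (W'.map ψ).toAffine.Point) = 0 := rfl
    rw [h0, addOrderOf_zero] at hord
    exact absurd hord (by norm_num)
  obtain ⟨-, hy⟩ := norm_threeTorsion_of_subrowB ψ hψ hu h3 hϖ0 hϖ1 W' hΔ ha₁ ha₃ ha₂ hP hord
  have hy0 : y ≠ 0 := by
    intro h; rw [h, norm_zero] at hy; norm_num at hy
  obtain ⟨j, hj⟩ := hval y hy0
  -- `ϱ^{2j} = ‖y‖^{2m'} = ϱ^{-3m'}`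
  have hpow : ‖ψ ϖ‖ ^ (2 * j) = ‖ψ ϖ‖ ^ (-(3 * (m' : ℤ))) := by
    have h1 : ‖y‖ ^ 2 = ‖ψ ϖ‖ ^ (-(3 : ℤ)) := by
      rw [zpow_neg, zpow_ofNat]; exact eq_inv_of_mul_eq_one_left hy
    calc ‖ψ ϖ‖ ^ (2 * j) = (‖y‖ ^ m') ^ (2 : ℤ) := by rw [hj, ← zpow_mul, mul_comm]
      _ = (‖y‖ ^ 2) ^ (m' : ℤ) := by
          rw [← zpow_natCast, ← zpow_mul, ← zpow_natCast, ← zpow_mul, mul_comm]; norm_cast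
      _ = ‖ψ ϖ‖ ^ (-(3 * (m' : ℤ))) := by rw [h1, ← zpow_mul, neg_mul]
  have hinj : 2 * j = -(3 * (m' : ℤ)) := (zpow_right_strictAnti₀ hϖ0 hϖ1).injective hpow
  obtain ⟨i, rfl⟩ := hm'
  omega

/-- **Sub-row A, index prime to `3`: every rational point of order `3` lies in the canonical subgroup.** If every
nonzero `z ∈ K` has `‖z‖^{m'} ∈ ‖ψ ϖ‖^ℤ` with `3 ∤ m'` (e.g. `M_w` itself), a point of order `3` on the good model
of a sub-row-A curve has `‖x‖·ϱ² = 1` and `‖y‖·ϱ³ = 1` (the six points with `‖x‖³ = ϱ⁻²` are not `K`-rational).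
[Serre 1972 §1; Katz 1973 Thm. 3.10.7] [cite: SilvermanAEC2009, IV.6.1] -/
theorem norm_threeTorsion_of_subrowA_of_not_three_dvd_index (W' : WeierstrassCurve O) (hΔ : IsUnit W'.Δ)
    (ha₁ : W'.a₁ = 0) (ha₃ : W'.a₃ = 0) (ha₂ : ∃ s₀ : O, IsUnit s₀ ∧ W'.a₂ = ϖ ^ 2 * s₀) {m' : ℕ}
    (hm' : ¬ 3 ∣ m') (hval : ∀ z : K, z ≠ 0 → ∃ j : ℤ, ‖z‖ ^ m' = ‖ψ ϖ‖ ^ j) {x y : K}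
    (hP : (W'.map ψ).toAffine.Nonsingular x y) (h3P : addOrderOf (WeierstrassCurve.Affine.Point.some x y hP) = 3) :
    ‖x‖ * ‖ψ ϖ‖ ^ 2 = 1 ∧ ‖y‖ * ‖ψ ϖ‖ ^ 3 = 1 := by
  rcases norm_threeTorsion_of_subrowA ψ hψ hu h3 hϖ0 hϖ1 W' hΔ ha₁ ha₃ ha₂ hP h3P with h | ⟨hx, -⟩
  · exact h
  exfalso
  have hx0 : x ≠ 0 := by
    intro h; rw [h, norm_zero] at hx; norm_num at hx
  obtain ⟨j, hj⟩ := hval x hx0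
  -- `ϱ^{3j} = ‖x‖^{3m'} = ϱ^{-2m'}`
  have hpow : ‖ψ ϖ‖ ^ (3 * j) = ‖ψ ϖ‖ ^ (-(2 * (m' : ℤ))) := by
    have h1 : ‖x‖ ^ 3 = ‖ψ ϖ‖ ^ (-(2 : ℤ)) := by
      rw [zpow_neg, zpow_ofNat]; exact eq_inv_of_mul_eq_one_left hx
    calc ‖ψ ϖ‖ ^ (3 * j) = (‖x‖ ^ m') ^ (3 : ℤ) := by rw [hj, ← zpow_mul, mul_comm]
      _ = (‖x‖ ^ 3) ^ (m' : ℤ) := by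
          rw [← zpow_natCast, ← zpow_mul, ← zpow_natCast, ← zpow_mul, mul_comm]; norm_cast
      _ = ‖ψ ϖ‖ ^ (-(2 * (m' : ℤ))) := by rw [h1, ← zpow_mul, neg_mul]
  have hinj : 3 * j = -(2 * (m' : ℤ)) := (zpow_right_strictAnti₀ hϖ0 hϖ1).injective hpow
  omega

end GoodModelPoints

/-! ## §2. From `ℚ`: the `3`-torsion of the (t′) good model over the tame quartic ring -/

section RatLevel

open WeierstrassCurve Literature.NumberTheory.EllipticCurves.Rank1Residual
  Summit.BirchSwinnertonDyer.Rank1Residual.Additive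

/-- **The valuations of the points of order `3` on the (t′) good model (Newton polygon of `Ψ₃`).** For `W/ℚ`
globally minimal, elliptic, `Addv W 3`, `SubTprime W 3`, and any `(O, φ : ℤ₃ → O, 3 = ϖ⁴u, u ∈ Oˣ, ϖ ∉ Oˣ)`: the
`ϖᵏ`-rescaled good model `W'` of `tprime_goodModel_formalMul_three_dichotomy` (displayed data as there) satisfies,
for every ultrametric normed field `K` receiving `O` integrally (`‖ψ x‖ ≤ 1`, `0 < ϱ = ‖ψ ϖ‖ < 1`) and every
`P = (x, y) ∈ (W' ⊗_ψ K)(K)` of order `3`: EITHER sub-row B (`c₆ = 0 ∨ ord₃ c₆ ≥ m + 2`) and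
`‖x‖ϱ = 1 ∧ ‖y‖²ϱ³ = 1`, OR sub-row A (`ord₃ c₆ = m`) and (`‖x‖ϱ² = 1 ∧ ‖y‖ϱ³ = 1` ∨ `‖x‖³ϱ² = 1 ∧ ‖y‖ϱ = 1`).
CONDITIONAL on nothing; credits nothing toward 21391. [Serre 1972 §1; Silverman AEC IV.6.1]
[cite: SilvermanAEC2009, IV.6.1] -/
theorem tprime_goodModel_threeTorsion_norm_dichotomy (W : WeierstrassCurve ℚ) [W.IsElliptic]
    [W.IsGloballyMinimal] (hadd : Addv W 3) (hsub : SubTprime W 3)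
    {O : Type*} [CommRing O] (φ : ℤ_[3] →+* O) {ϖ u : O} (hu : IsUnit u) (h3 : (3 : O) = ϖ ^ 4 * u)
    (hϖ : ¬ IsUnit ϖ) :
    ∃ (V : WeierstrassCurve ℤ_[3]) (T : WeierstrassCurve.VariableChange ℤ_[3]) (k m : ℕ)
      (W' : WeierstrassCurve O),
      V.map (algebraMap ℤ_[3] ℚ_[3]) = W.baseChange ℚ_[3] ∧ ((k = 1 ∧ m = 3) ∨ (k = 3 ∧ m = 6)) ∧
      padicValRat 3 W.Δ = 3 * k ∧ W'.a₁ = 0 ∧ W'.a₃ = 0 ∧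
      ϖ ^ (2 * k) * W'.a₂ = φ (T • V).a₂ ∧ ϖ ^ (4 * k) * W'.a₄ = φ (T • V).a₄ ∧
      ϖ ^ (6 * k) * W'.a₆ = φ (T • V).a₆ ∧ IsUnit W'.Δ ∧
      ∀ {K : Type*} [NormedField K] [IsUltrametricDist K] [DecidableEq K] (ψ : O →+* K),
        (∀ x, ‖ψ x‖ ≤ 1) → 0 < ‖ψ ϖ‖ → ‖ψ ϖ‖ < 1 → ∀ (x y : K) (hP : (W'.map ψ).toAffine.Nonsingular x y),
        addOrderOf (WeierstrassCurve.Affine.Point.some x y hP) = 3 →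
          ((W.c₆ = 0 ∨ (m + 2 : ℤ) ≤ padicValRat 3 W.c₆) ∧ (‖x‖ * ‖ψ ϖ‖ = 1 ∧ ‖y‖ ^ 2 * ‖ψ ϖ‖ ^ 3 = 1)) ∨
          ((W.c₆ ≠ 0 ∧ padicValRat 3 W.c₆ = m) ∧
            ((‖x‖ * ‖ψ ϖ‖ ^ 2 = 1 ∧ ‖y‖ * ‖ψ ϖ‖ ^ 3 = 1) ∨ (‖x‖ ^ 3 * ‖ψ ϖ‖ ^ 2 = 1 ∧ ‖y‖ * ‖ψ ϖ‖ = 1))) := by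
  obtain ⟨V, T, k, m, W', hVmap, hkm, hΔval, -, -, hW'a₁, hW'a₃, ha₂, ha₄, ha₆, hunit, hcases⟩ :=
    tprime_goodModel_formalMul_three_dichotomy W hadd hsub φ hu h3 hϖ
  refine ⟨V, T, k, m, W', hVmap, hkm, hΔval, hW'a₁, hW'a₃, ha₂, ha₄, ha₆, hunit, ?_⟩
  intro K _ _ _ ψ hψ hϖ0 hϖ1 x y hP h3P
  rcases hcases with ⟨hB1, hB2, -⟩ | ⟨hA1, hA2, -⟩
  · exact Or.inl ⟨hB2, norm_threeTorsion_of_subrowB ψ hψ hu h3 hϖ0 hϖ1 W' hunit hW'a₁ hW'a₃ hB1 hP h3P⟩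
  · exact Or.inr ⟨hA2, norm_threeTorsion_of_subrowA ψ hψ hu h3 hϖ0 hϖ1 W' hunit hW'a₁ hW'a₃ hA1 hP h3P⟩

/-- **Sub-row B of the (t′) leaf: the good model has NO rational `3`-torsion over the completion of the tame
quartic field and over its whole `3`-cyclotomic tower.** For `W` as above on sub-row B (`c₆ = 0 ∨ ord₃ c₆ ≥ m + 2`;
1 058 of the 7 663 (t′) classes with `N < 5·10⁵`, all 147 irreducible-not-onto ones — memo TPRIME-LOCAL-SHAPE-w3g5),
and any ultrametric `K` receiving `O` integrally whose value group has ODD index over `‖ψ ϖ‖^ℤ`: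
**`3 • P = 0 ⇒ P = 0` on `(W' ⊗_ψ K)(K)`**. (Over such `K` the reduction of `W'` is supersingular, so this is
`E(K)[3] = 0` for the curve `E ≅ W'` over `K`; the `K`-isomorphism with `W ⊗ K` is the rescaling by `ϖᵏ` composed
with `T`.) [Serre 1972 §1] [cite: SilvermanAEC2009, IV.6.1] -/
theorem tprime_goodModel_no_threeTorsion_of_subrowB_oddIndex (W : WeierstrassCurve ℚ) [W.IsElliptic]
    [W.IsGloballyMinimal] (hadd : Addv W 3) (hsub : SubTprime W 3)
    {O : Type*} [CommRing O] (φ : ℤ_[3] →+* O) {ϖ u : O} (hu : IsUnit u) (h3 : (3 : O) = ϖ ^ 4 * u)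
    (hϖ : ¬ IsUnit ϖ) :
    ∃ (V : WeierstrassCurve ℤ_[3]) (T : WeierstrassCurve.VariableChange ℤ_[3]) (k m : ℕ)
      (W' : WeierstrassCurve O),
      V.map (algebraMap ℤ_[3] ℚ_[3]) = W.baseChange ℚ_[3] ∧ ((k = 1 ∧ m = 3) ∨ (k = 3 ∧ m = 6)) ∧
      padicValRat 3 W.Δ = 3 * k ∧ W'.a₁ = 0 ∧ W'.a₃ = 0 ∧
      ϖ ^ (2 * k) * W'.a₂ = φ (T • V).a₂ ∧ ϖ ^ (4 * k) * W'.a₄ = φ (T • V).a₄ ∧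
      ϖ ^ (6 * k) * W'.a₆ = φ (T • V).a₆ ∧ IsUnit W'.Δ ∧
      ((W.c₆ = 0 ∨ (m + 2 : ℤ) ≤ padicValRat 3 W.c₆) →
        ∀ {K : Type*} [NormedField K] [IsUltrametricDist K] [DecidableEq K] (ψ : O →+* K),
          (∀ x, ‖ψ x‖ ≤ 1) → 0 < ‖ψ ϖ‖ → ‖ψ ϖ‖ < 1 → ∀ {m' : ℕ}, Odd m' →
          (∀ z : K, z ≠ 0 → ∃ j : ℤ, ‖z‖ ^ m' = ‖ψ ϖ‖ ^ j) →
          ∀ P : (W'.map ψ).toAffine.Point, 3 • P = 0 → P = 0) := by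
  obtain ⟨V, T, k, m, W', hVmap, hkm, hΔval, -, -, hW'a₁, hW'a₃, ha₂, ha₄, ha₆, hunit, hcases⟩ :=
    tprime_goodModel_formalMul_three_dichotomy W hadd hsub φ hu h3 hϖ
  refine ⟨V, T, k, m, W', hVmap, hkm, hΔval, hW'a₁, hW'a₃, ha₂, ha₄, ha₆, hunit, ?_⟩
  intro hB K _ _ _ ψ hψ hϖ0 hϖ1 m' hm' hval P h3P
  rcases hcases with ⟨hB1, -, -⟩ | ⟨-, ⟨hc₆, hval₆⟩, -⟩
  · exact threeTorsion_eq_zero_of_subrowB_oddIndex ψ hψ hu h3 hϖ0 hϖ1 W' hunit hW'a₁ hW'a₃ hB1 hm' hval P h3P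
  · exfalso
    rcases hB with h0 | hle
    · exact hc₆ h0
    · rw [hval₆] at hle; exact absurd hle (by omega)

end RatLevel

end Summit.BirchSwinnertonDyer.BirchSwinnertonDyer.Theorems.SolventPairLowerBound

end
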